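import Summits.CriticalPhenomena.SAWScalingLimit.Theses.SAWDefectDecoherence

/-!
# drefute scratch — repaired gate definitions for `RenewalAccumulation` (line `bridge-gate-renewal`)

The vocabulary block (`rowCoord … sideVerts`, `HasCleanWindow`) is copied VERBATIM from
`Cruxes/ObservableToSLER/Lines/bridge-gate-renewal.lean`; the new declarations are
`IsSepGate`, `IsFirstSepGate`, `SepRenewalAt`, `RenewalAccumulationSep` (proposed replacement of
`IsGoodGate` / `IsFirstGoodGate` / `GoodRenewalAt` / `RenewalAccumulation`), and the definitional
lemma `not_isGoodGate_of_suffix_meets_side` (Lemma A of Negative-notes/RenewalAccumulation.md).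
-/

noncomputable section

open scoped BigOperators Topology NNReal ENNReal Classical
open Filter Set MeasureTheory Metric
open Literature.Probability.LatticeModels (HexVertex hexGraph hexCenter triZeta Site)
open Literature.Probability.RandomPlanarGeometry
open Literature.Probability.RandomPlanarGeometry.SAW

namespace Summit.CriticalPhenomena.SAWScalingLimit.Cruxes.ObservableToSLER.DrefuteRA

/-! ## Vocabulary (verbatim copy of the line's block) -/

def rowCoord (i : Fin 3) (v : HexVertex) : ℤ :=
  if i = 0 then v.1 1 else if i = 1 then v.1 0 else v.1 0 + v.1 1 + (v.2 : ℕ)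

def rowOf (k : Fin 6) (v : HexVertex) : ℤ :=
  ![rowCoord 0 v, -rowCoord 1 v, -rowCoord 2 v, -rowCoord 0 v, rowCoord 1 v, rowCoord 2 v] k

def hexBall (c : HexVertex) (n : ℕ) : Set HexVertex :=
  {v | ∀ i : Fin 3, |rowCoord i v - rowCoord i c| ≤ n}

def skewCoord (i : Fin 3) (z : ℂ) : ℝ :=
  ![2 * z.im / Real.sqrt 3, z.re - z.im / Real.sqrt 3, z.re + z.im / Real.sqrt 3] i

def contHex (δ : ℝ) (c : HexVertex) (n : ℕ) : Set ℂ :=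
  {z | ∀ i : Fin 3, (rowCoord i c : ℝ) - n ≤ skewCoord i (z / δ) ∧
    skewCoord i (z / δ) ≤ (rowCoord i c : ℝ) + n + 1}

def gatePoint (δ : ℝ) (p q : HexVertex) : ℂ :=
  (δ : ℂ) * (hexCenter p + hexCenter q) / 2

def gateCut (Ω : Set ℂ) (δ : ℝ) (c : HexVertex) (n : ℕ) (p q : HexVertex) : Set ℂ :=
  connectedComponentIn (frontier (contHex δ c n) ∩ Ω) (gatePoint δ p q)

def gateSide (Ω : Set ℂ) (δ : ℝ) (c : HexVertex) (n : ℕ) (p q : HexVertex) : Set ℂ :=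
  connectedComponentIn (Ω \ gateCut Ω δ c n p q) ((δ : ℂ) * hexCenter p)

def sideVerts (Ω : Set ℂ) (δ : ℝ) (c : HexVertex) (n : ℕ) (p q : HexVertex) : Set HexVertex :=
  {v | (δ : ℂ) * hexCenter v ∈ gateSide Ω δ c n p q}

def HasCleanWindow (Ω : Set ℂ) (δ ρ : ℝ) (S : Set HexVertex) (p q : HexVertex) : Prop :=
  closedBall ((δ : ℂ) * hexCenter q) ρ ⊆ Ω ∧
    ∃ k : Fin 6, rowOf k q = rowOf k p + 1 ∧
      ∀ x : HexVertex, (δ : ℂ) * hexCenter x ∈ ball ((δ : ℂ) * hexCenter q) ρ →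
        (x ∈ S ↔ rowOf k x ≤ rowOf k p)

def IsFirstExit (c : HexVertex) (n : ℕ) (l : List HexVertex) (m : ℕ) (p q : HexVertex) : Prop :=
  (l.take m).getLast? = some p ∧ (l.drop m).head? = some q ∧
    (∀ v ∈ l.take m, v ∈ hexBall c n) ∧ q ∉ hexBall c n

def IsGoodGate (Ω : Set ℂ) (δ r R ρ : ℝ) (c : HexVertex) (l : List HexVertex) (n m : ℕ)
    (p q : HexVertex) : Prop :=
  r ≤ n * δ ∧ n * δ ≤ R ∧ IsFirstExit c n l m p q ∧
    (∀ v ∈ l.drop m, v ∉ sideVerts Ω δ c n p q) ∧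
    HasCleanWindow Ω δ ρ (sideVerts Ω δ c n p q) p q

/-! ## Lemma A (definitional half): a gate whose root side contains a later vertex is not good.
The geometric half — if the crosscut through the FIRST-EXIT edge does not separate `δ·c` from the
far endpoint then the far endpoint (last vertex of `l`, a member of `l.drop m`) lies in
`sideVerts` — is in the note. -/
theorem not_isGoodGate_of_suffix_meets_side {Ω : Set ℂ} {δ r R ρ : ℝ} {c : HexVertex}
    {l : List HexVertex} {n m : ℕ} {p q : HexVertex}
    (h : ∃ v ∈ l.drop m, v ∈ sideVerts Ω δ c n p q) :
    ¬ IsGoodGate Ω δ r R ρ c l n m p q := by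
  rintro ⟨-, -, -, hsuf, -⟩
  obtain ⟨v, hv, hvS⟩ := h
  exact hsuf v hv hvS

/-- If the last vertex of the list lies in the root side of the gate at index `m < l.length`,
the gate is not good (the far endpoint `b_δ = l.getLast` is a member of `l.drop m`). -/
theorem not_isGoodGate_of_getLast_mem_side {Ω : Set ℂ} {δ r R ρ : ℝ} {c : HexVertex}
    {l : List HexVertex} {n m : ℕ} {p q : HexVertex} (hm : m < l.length) (hl : l ≠ [])
    (h : l.getLast hl ∈ sideVerts Ω δ c n p q) :
    ¬ IsGoodGate Ω δ r R ρ c l n m p q := by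
  refine not_isGoodGate_of_suffix_meets_side ⟨l.getLast hl, ?_, h⟩
  have hne : l.drop m ≠ [] := by
    simp [List.drop_eq_nil_iff, not_le.mpr hm]
  have : (l.drop m).getLast hne = l.getLast hl := List.getLast_drop hne
  rw [← this]
  exact List.getLast_mem hne

/-! ## Proposed repair: SEPARATING-crosscut gates (first exit from the lattice hexagon is dropped;
the walk may leave and re-enter the hexagon through non-separating arcs before the gate). -/

/-- A **separating single-crossing gate** of `l` at level `n` through the edge `{p,q} = {l[m-1], l[m]}`:
the edge crosses `∂(contHex δ c n)` outwards (`p ∈ hexBall`, `q ∉ hexBall`), the crosscut of `Ω`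
through its gate point SEPARATES the root side from the far endpoint `far` (for the `a`-end,
`far = b_δ`; for the reversed list, `far = a_δ`), the prefix lies in the root side `U`, the suffix
avoids `U` (so the crosscut is crossed exactly once), and the gate carries a clean flat window. -/
def IsSepGate (Ω : Set ℂ) (δ r R ρ : ℝ) (c far : HexVertex) (l : List HexVertex) (n m : ℕ)
    (p q : HexVertex) : Prop :=
  r ≤ n * δ ∧ n * δ ≤ R ∧
    (l.take m).getLast? = some p ∧ (l.drop m).head? = some q ∧ p ∈ hexBall c n ∧ q ∉ hexBall c n ∧
    far ∉ sideVerts Ω δ c n p q ∧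
    (∀ v ∈ l.take m, v ∈ sideVerts Ω δ c n p q) ∧
    (∀ v ∈ l.drop m, v ∉ sideVerts Ω δ c n p q) ∧
    HasCleanWindow Ω δ ρ (sideVerts Ω δ c n p q) p q

/-- The FIRST separating gate: minimal crossing INDEX `m` (prefix-determined by the nesting lemma
of the note: a separating crosscut met by the prefix has its root side inside `U`). -/
def IsFirstSepGate (Ω : Set ℂ) (δ r R ρ : ℝ) (c far : HexVertex) (l : List HexVertex) (n m : ℕ)
    (p q : HexVertex) : Prop :=
  IsSepGate Ω δ r R ρ c far l n m p q ∧
    ∀ (n' m' : ℕ) (p' q' : HexVertex), IsSepGate Ω δ r R ρ c far l n' m' p' q' → m ≤ m'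

/-- `l` has a separating single-crossing gate at some level of the window. -/
def SepRenewalAt (Ω : Set ℂ) (δ r R ρ : ℝ) (c far : HexVertex) (l : List HexVertex) : Prop :=
  ∃ (n m : ℕ) (p q : HexVertex), IsSepGate Ω δ r R ρ c far l n m p q

/-- **RA′ — the repaired renewal accumulation** (same quantifier shape as the line's
`RenewalAccumulation`; only the gate notion changes). -/
def RenewalAccumulationSep : Prop :=
  ∀ (D : DobrushinDomain) (a b : ℝ → HexVertex), IsEmbEndpointApprox hexGraph hexCenter D a b →
    ∀ ε > (0 : ℝ), ∀ R > (0 : ℝ), ∃ r ∈ Set.Ioo (0 : ℝ) R, ∃ ρ > (0 : ℝ), ∀ᶠ δ : ℝ in 𝓝[>] 0,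
      hexSAWLaw D.carrier δ (a δ) (b δ)
          {γ | ¬ (SepRenewalAt D.carrier δ r R ρ (a δ) (b δ) γ.walk.support ∧
                  SepRenewalAt D.carrier δ r R ρ (b δ) (a δ) γ.walk.support.reverse)} ≤
        ENNReal.ofReal ε

end Summit.CriticalPhenomena.SAWScalingLimit.Cruxes.ObservableToSLER.DrefuteRA

end
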